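import Summits.AtomisticToContinuum.BoseEinsteinCondensation.Theses.BECCutLineWeakDisorder
import Literature.MathematicalPhysics.QuantumManyBody.GroundStateFeynmanKacCutLine
import Literature.MathematicalPhysics.QuantumManyBody.SwapPurity
import Mathlib
import HarnessLib

/-!
# Stub `stub_uvFlatness` (crux stmt-AtomisticToContinuum-9087, line sibling-telescoping-chaining)

Work file of the stub-worker. OUTCOME: `stub-blocked` — the statement is (plausibly) true but its
one analytic input is absent from the tree; this file contains the AUDIT NOTES (below), local
verbatim copies of the line's vocabulary (to be replaced by the lead's `…SiblingDefs` module), the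
precise Lean statement of the missing input (`PartitionUVBound`, two equivalent readings), and the
KERNEL-CHECKED reduction `uvFlatness_of_partitionUVBound : PartitionUVBound → UVFlatness`
(constant `C ↦ C²`), plus the scale-invariance / normalisation glue it needs.

## Audit of the statement (job 1)

`UVFlatness`: for admissible `v`, `ρ < ρ₀(v)`, some `C`, eventually in `n`, all `T ≥ 1`:
`∫ m(Y) · r̄_K(Y)² dY ≤ C`, `m(Y) = ∫ g_Y²`, `g_Y = |Ψ_T(·::Y)|`, `Ψ_T = fkWitness v L T 1`,
`r̄_K = uvParticipation g_Y L K = ℓ³ (∫ g²) / Σ_Q (∫_Q g)²`, `ℓ = L/2^K ∈ (1/4, 1]`.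

* Junk / vacuity.
  - `fkNormSq ∈ {0, ⊤}` ⇒ `fkWitness ≡ 0` ⇒ integrand `0 · (0/0)² = 0`: harmless (and `fkNormSq ≤ L^{3N}
    < ⊤` since `e^{-TH}1 ≤ 1` vanishes off the box; `fkNormSq = 0` impossible at low density for
    large boxes, but not needed).
  - Nondegenerate case, fixed `Y`: `g_Y ≤ 1/√𝒩`, vanishes off `Λ_L` ⇒ `∫ g_Y < ⊤` ⇒ `levelSq ≠ ⊤`;
    `m(Y) = 0 ⇒ g_Y = 0` a.e. ⇒ `r̄ = 0/… = 0`; `m(Y) > 0 ⇒ levelSq ≠ 0` (blocks cover the box) ⇒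
    `r̄_K(Y) < ⊤` and `r̄_K ≥ 1` (Cauchy–Schwarz blockwise). So `r̄_K` is finite `m dY`-a.e.; the
    LHS is `≥ 1` whenever `𝒩 ∉ {0,⊤}` (so `C ≥ 1`, consistent with `Negative.one_le_const…`).
  - Parsing checked: `∫⁻ x, slice … Y x ^ 2 = ∫ (g_Y x)²`; `uvParticipation … ^ 2 = (r̄_K)²`;
    `a * b / c = (a*b)/c`; `depth L = clog₂ ⌈L⌉` gives `ℓ ∈ (L/(2(L+1)), 1]`; `dyadicCube` tiles
    `[0,L)³ ⊇ Λ_L`. No misstatement found at the type level.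
* Falsity candidates examined (none succeeds; numbers, not adjectives):
  - `v = 0` (admissible): `Ψ_T` is a product, `r̄_K(Y) = ∏_{d=1}^3 r̄^{1D}(s_T)` is `Y`-independent,
    `s_T` = 1D survival profile; `r̄^{1D} → 1` as `L → ∞` uniformly in `T ≥ 1` (wall blocks: linear
    profile ⇒ ratio `4/3`, a fraction `ℓ/L` of the blocks; `T ≫ L²`: sine profile ⇒ `1 + O(ℓ²/L²)`).
    So `E_m[r̄²] → 1`: consistent.
  - Hard cores `v = ⊤·1_{[0,R₀]}`, crowding: a block `Q` with free pocket of volume `ε` has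
    `P_Q := ℓ³∫_Q g²/(∫_Q g)² ~ ℓ³/ε → ∞`, but weight `a_Q² ~ ε²`: contribution `a_Q² P_Q ~ ε → 0`.
    ALL mass-carrying blocks crowded needs `≳ L³/R₀³ = N/(ρR₀³) ≫ N` bath particles once
    `ρ₀ < R₀^{-3}` (we choose `ρ₀` after `v`): impossible eventually in `n`. Sealed unit cells (foam)
    need `~1/R₀²` particles each ⇒ cover volume `≲ N R₀² ≪ L³`. Pockets are SUPPRESSED, not
    amplified (caged tagged particle: contact within time `O(δ²)`; the cage dissolves in `O(R₀²)`).
  - Hard/soft shells `v = ⊤·1_{[a,R₀]}` (bound pairs, disconnected accessible region): bound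
    component decays like `e^{-cT/a²}` vs free `e^{-cρR₀T}`; at `ρ₀(v)` small the free plateau
    dominates every slice for all `T ≥ 1` ⇒ no sub-unit spikes. `v` only matters through its
    Lebesgue a.e.-class (occupation density of `|Bⁱ-Bʲ|`).
  - `T → ∞`: `Ψ_T → Ψ₀` (Jastrow-flat at unit scale away from cores; kinetic energy per particle
    `E_{Ψ²}|∇_x log Ψ|² = O(ρa)` uniformly in `N`), `T = 1`: heat smoothing length `√(4T) = 2 ≥ ℓ`;
    `T → 0` would even give `r̄ → 1`. Wall layer of width `√T ∧ L`: linear profile, ratio `≤ (4/3)³`.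
  Verdict: no counterexample; the statement is the intended physics (within-block flatness of the
  conditional amplitude at the fixed unit scale) and is plausibly TRUE for every admissible `v`.
* Why it is not provable here (job 2; `lean search`/`lean find` done): the tree's FK library has the
  Gaussian law, `L² → L^∞` with constant `(4πt)^{-3N/4}` (dimension-dependent, useless), exit
  bounds, tube positivity, Markov/cut identities, Perron–Frobenius — NO regularity of
  `x ↦ (e^{-TH_N}1)(x::Y)` in ONE particle's variable uniform in `N`, `T` (no parabolic Harnack /
  oscillation / reverse-Hölder / Caccioppoli for the many-body functional; the FluidPDE Harnack and
  Caccioppoli files are one-body PDE statements with no bridge to `fkSemigroup`). Stockroom: nothing.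
  Naive routes fail exactly as the brief warns: Cameron–Martin + Hölder gives only power-Harnack
  `Z(x')^p ≤ C Z(x)` (useless when `Z ~ e^{-μT}`); coupling gives additive errors; the full
  `3N`-dimensional parabolic Harnack has constant `e^{O(N)}`.

## The missing input, and two analytic routes to it (job 3)

THE ONE MISSING FACT (stated below as `PartitionUVBound`, kernel-checked to imply the stub with
`C ↦ C²` via `∫ m = 1`): UV flatness of EVERY slice of the tagged half-line partition function,
  `ℓ³ ∫ Z_T(x::Y)² dx ≤ C · Σ_{|Q| = ℓ} (∫_Q Z_T(x::Y) dx)²`   for a.e. bath configuration `Y`,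
`Z_T = fkSemigroup v L T 1 = e^{-TH_N}1`, uniformly in `T ≥ 1`, eventually in `n` (scale-free in
`Z`, so no normalisation enters: `uvParticipation_const_mul`, `slice_fkWitness_eq_const_mul`).
USE BY THE LEAD (reshape option): register `stub_partitionUVBound : PartitionUVBound` in place of
`stub_uvFlatness` and close the latter by `uvFlatness_of_partitionUVBound` (this file, sorry-free,
axioms {propext, Classical.choice, Quot.sound}); the local copies of the six defs and of
`UVFlatness` are verbatim and disappear on importing the Defs module.
Routes to it (paper level; each is a research-level one-variable regularity statement):
 (R1) Nash + Jensen (checked on paper, 10 lines): Nash on a cube of side `ℓ ∈ (1/4,1]`,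
      `‖g‖₂^{10/3} ≤ C_N(‖∇g‖₂² + 16‖g‖₂²)‖g‖₁^{4/3}`, gives `P_Q ≤ C'(1 + τ_Q)^{3/2}` with
      `τ_Q = ∫_Q|∇g|²/∫_Q g²`; convexity of `τ ↦ (1+τ)^{-3/2}` under the weights `∫_Q g²/∫ g²` gives
      `r̄_K(Y) ≤ C'(1 + t(Y))^{3/2}`, `t(Y) = ∫|∇_x Ψ_T(x::Y)|²dx / ∫ Ψ_T(x::Y)² dx` = Rayleigh
      quotient of the slice in the tagged variable. So `PartitionUVBound ⟸ ess-sup_Y t(Y) ≤ t_max`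
      (one-variable reverse Poincaré for `e^{-TH_N}1`), and the stub itself ⟸ `E_m[(1+t)³] ≤ C`;
      NB `E_m[t] = (kinetic energy of Ψ_T)/N` by symmetry = `O(1)` for `T ≥ 1` (log-convexity of
      `T ↦ ‖e^{-TH}1‖²` + a Jastrow trial bound) — only the first moment is "energy-cheap". The
      slice is H¹ but NOT Lipschitz/C¹ in general (wedge singularities where exclusion spheres of
      two bath particles meet), so a Lean statement of `t` needs weak gradients (not in Mathlib).
 (R2) Harnack + non-amplification: (H1) interior one-variable Harnack
      `Z_T(x::Y) ≤ C_H Z_T(x'::Y)` for `|x-x'| ≤ 2`, both at distance `≥ R₀+1` from bath and walls —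
      FALSE pointwise in `Y` with `N`-uniform `C_H` for soft (bounded) `v`: a pile-up of `k` bath
      particles at distance `R₀+1+s` from `x'` and `R₀+3+s` from `x` expands with an opaque front
      `r(t) ≈ √(4t log k)`; outrunning it costs `(log k/4)·log(T*/t_d)`, so
      `Z(x::Y)/Z(x'::Y) ≳ k^{(1/2) log((3+s)/(1+s))} → ∞` in `k` (hard cores forbid pile-ups:
      plausible there, or under a multiscale no-crowding hypothesis
      `#(Y ∩ B(x, R₀+r)) ≤ k₀ e^{r²/16}` for all `r ≥ 1`); (H2) the slice mass within distance `R₀+2` of bath/walls is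
      `≤ C ×` the mass on free blocks (Carleson-type upper bound; pockets are the obstruction to any
      purely local form). (H1)+(H2) ⇒ `PartitionUVBound` by `(A+B)/(A'+B') ≤ A/A' + B/A'`.
-/

noncomputable section

open MeasureTheory Filter Set Finset
open scoped ENNReal NNReal Topology BigOperators

namespace Summit.AtomisticToContinuum.BoseEinsteinCondensation.Cruxes.LandscapeBound.SiblingTelescopingChaining

open Literature.MathematicalPhysics.QuantumManyBody.BoseGas
open Summit.AtomisticToContinuum.BoseEinsteinCondensation.Theses.BECCutLineWeakDisorder

/-! ### LOCAL verbatim copies of the line's vocabulary (lead lands them as `…SiblingDefs`; drop on import) -/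

/-- Number of dyadic levels used in a box of side `L`: `K = ⌈log₂ ⌈L⌉⌉`. [folklore] -/
def depth (L : ℝ) : ℕ := Nat.clog 2 ⌈L⌉₊

/-- The dyadic block of level `j` with multi-index `i`. [folklore] -/
def dyadicCube (L : ℝ) (j : ℕ) (i : Fin 3 → Fin (2 ^ j)) : Set Space :=
  {x | ∀ d : Fin 3, x d ∈ Set.Ico (L * (i d : ℕ) / 2 ^ j) (L * ((i d : ℕ) + 1) / 2 ^ j)}

/-- `a_Q = ∫_Q g`. [folklore] -/
def blockMass (g : Space → ℝ≥0∞) (L : ℝ) (j : ℕ) (i : Fin 3 → Fin (2 ^ j)) : ℝ≥0∞ :=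
  ∫⁻ x in dyadicCube L j i, g x

/-- `S_j = Σ_{|Q| = L2^{-j}} a_Q²`. [folklore] -/
def levelSq (g : Space → ℝ≥0∞) (L : ℝ) (j : ℕ) : ℝ≥0∞ :=
  ∑ i : Fin 3 → Fin (2 ^ j), blockMass g L j i ^ 2

/-- `r̄_K = ℓ_K³ (∫ g²) / S_K`. [folklore] -/
def uvParticipation (g : Space → ℝ≥0∞) (L : ℝ) (K : ℕ) : ℝ≥0∞ :=
  ENNReal.ofReal ((L / 2 ^ K) ^ 3) * (∫⁻ x, g x ^ 2) / levelSq g L K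

/-- The slice `x ↦ |Ψ(x, Y)|`. [folklore] -/
def slice {n : ℕ} (Ψ : Config (n + 1) → ℝ) (Y : Config n) (x : Space) : ℝ≥0∞ :=
  (‖Ψ (Matrix.vecCons x Y)‖₊ : ℝ≥0∞)

/-- LOCAL verbatim copy of the stub statement `UVFlatness` (skeleton, read-only). [folklore] -/
def UVFlatness : Prop :=
  ∀ v : ℝ → ℝ≥0∞, IsRepulsiveFiniteRange v → ∃ ρ₀ : ℝ, 0 < ρ₀ ∧ ∀ ρ : ℝ, 0 < ρ → ρ < ρ₀ →
    ∃ C : ℝ, 0 < C ∧ ∀ᶠ n : ℕ in atTop, ∀ T : ℝ, 1 ≤ T →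
      ∫⁻ Y : Config n,
          (∫⁻ x, slice (fkWitness (N := n + 1) v (sideLength ρ (n + 1)) T (fun _ => (1 : ℝ≥0∞))) Y x ^ 2) *
            uvParticipation
              (slice (fkWitness (N := n + 1) v (sideLength ρ (n + 1)) T (fun _ => (1 : ℝ≥0∞))) Y)
              (sideLength ρ (n + 1)) (depth (sideLength ρ (n + 1))) ^ 2 ≤
        ENNReal.ofReal C

/-! ### The missing analytic input, as a Lean statement -/

/-- **THE MISSING INPUT `PartitionUVBound` (UV flatness of every slice of the tagged half-line
partition function).** For admissible `v`, `ρ < ρ₀(v)`, some `C`, eventually in `n`, uniformly in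
`T ≥ 1`, for a.e. bath configuration `Y ∈ (ℝ³)^n`: with `L = sideLength ρ (n+1)`, `K = depth L`,
`ℓ = L2^{-K} ∈ (1/4, 1]` and `Z_T = e^{-TH_{n+1}}1 = fkSemigroup v L T 1` (`= fkPartition`),
  `ℓ³ ∫ Z_T(x::Y)² dx ≤ C · Σ_{|Q| = ℓ} (∫_Q Z_T(x::Y) dx)²`,
i.e. `uvParticipation (x ↦ Z_T(x::Y)) L K ≤ C`: the `a_Q²`-weighted mean over the unit blocks of
the within-block participation ratios of the slice is bounded — one-variable, unit-scale
regularity of the many-body Feynman–Kac functional (reverse Hölder `L²`–`L¹` on unit cubes, in the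
globally weighted form that tolerates hard-core pockets). Absent from the tree and from Mathlib;
see the module docstring for the two analytic routes (Nash + slice Rayleigh quotient; one-variable
Harnack + non-amplification). [folklore] -/
def PartitionUVBound : Prop :=
  ∀ v : ℝ → ℝ≥0∞, IsRepulsiveFiniteRange v → ∃ ρ₀ : ℝ, 0 < ρ₀ ∧ ∀ ρ : ℝ, 0 < ρ → ρ < ρ₀ →
    ∃ C : ℝ, 0 < C ∧ ∀ᶠ n : ℕ in atTop, ∀ T : ℝ, 1 ≤ T → ∀ᵐ Y : Config n,
      uvParticipation
          (fun x => fkSemigroup (N := n + 1) v (sideLength ρ (n + 1)) T (fun _ => (1 : ℝ≥0∞))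
            (Matrix.vecCons x Y))
          (sideLength ρ (n + 1)) (depth (sideLength ρ (n + 1))) ≤
        ENNReal.ofReal C

/-- The same input read on the normalised witnesses: `ess sup_Y r̄_K(|Ψ_T(·::Y)|) ≤ C`
(equivalent to `PartitionUVBound` whenever `‖e^{-TH}1‖₂ ∉ {0, ∞}`, by scale invariance of
`uvParticipation`; trivially true in the degenerate case). [folklore] -/
def SliceUVBound : Prop :=
  ∀ v : ℝ → ℝ≥0∞, IsRepulsiveFiniteRange v → ∃ ρ₀ : ℝ, 0 < ρ₀ ∧ ∀ ρ : ℝ, 0 < ρ → ρ < ρ₀ →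
    ∃ C : ℝ, 0 < C ∧ ∀ᶠ n : ℕ in atTop, ∀ T : ℝ, 1 ≤ T → ∀ᵐ Y : Config n,
      uvParticipation
          (slice (fkWitness (N := n + 1) v (sideLength ρ (n + 1)) T (fun _ => (1 : ℝ≥0∞))) Y)
          (sideLength ρ (n + 1)) (depth (sideLength ρ (n + 1))) ≤
        ENNReal.ofReal C

/-! ### Scale invariance of the UV participation -/

theorem blockMass_const_mul {c : ℝ≥0∞} (hc : c ≠ ⊤) (g : Space → ℝ≥0∞) (L : ℝ) (j : ℕ)
    (i : Fin 3 → Fin (2 ^ j)) :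
    blockMass (fun x => c * g x) L j i = c * blockMass g L j i := by
  unfold blockMass
  exact lintegral_const_mul' c _ hc

theorem levelSq_const_mul {c : ℝ≥0∞} (hc : c ≠ ⊤) (g : Space → ℝ≥0∞) (L : ℝ) (j : ℕ) :
    levelSq (fun x => c * g x) L j = c ^ 2 * levelSq g L j := by
  unfold levelSq
  rw [Finset.mul_sum]
  refine Finset.sum_congr rfl fun i _ => ?_
  rw [blockMass_const_mul hc, mul_pow]

/-- **`r̄_K` is scale-free**: `uvParticipation (c·g) = uvParticipation g` for `c ∈ (0, ∞)`.
[folklore] -/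
theorem uvParticipation_const_mul {c : ℝ≥0∞} (hc0 : c ≠ 0) (hc : c ≠ ⊤) (g : Space → ℝ≥0∞)
    (L : ℝ) (K : ℕ) :
    uvParticipation (fun x => c * g x) L K = uvParticipation g L K := by
  unfold uvParticipation
  have h2 : ∫⁻ x, (c * g x) ^ 2 = c ^ 2 * ∫⁻ x, g x ^ 2 := by
    simp_rw [mul_pow]
    exact lintegral_const_mul' _ _ (ENNReal.pow_ne_top hc)
  rw [h2, levelSq_const_mul hc, mul_left_comm,
    ENNReal.mul_div_mul_left _ _ (pow_ne_zero 2 hc0) (ENNReal.pow_ne_top hc)]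

/-! ### The witness slice is a constant multiple of the partition-function slice -/

section Witness

variable {n : ℕ}

/-- Degenerate normalisation makes the witness vanish identically (private copy of the
skeleton's lemma). [folklore] -/
theorem fkWitness_eq_zero_of_normSq' {v : ℝ → ℝ≥0∞} {L T : ℝ} {g : Config (n + 1) → ℝ≥0∞}
    (h : fkNormSq (N := n + 1) v L T g = 0 ∨ fkNormSq (N := n + 1) v L T g = ⊤)
    (X : Config (n + 1)) : fkWitness (N := n + 1) v L T g X = 0 := by
  have h0 : (fkNormSq (N := n + 1) v L T g).toReal = 0 := by
    rcases h with h | h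
    · rw [h, ENNReal.toReal_zero]
    · rw [h, ENNReal.toReal_top]
  rw [fkWitness_apply, h0, Real.sqrt_zero, div_zero]

/-- `‖r‖₊ = ofReal r` for the nonnegative witness (private copy of the skeleton's lemma).
[folklore] -/
theorem coe_nnnorm_fkWitness' (v : ℝ → ℝ≥0∞) (L T : ℝ) (g : Config (n + 1) → ℝ≥0∞)
    (X : Config (n + 1)) :
    ((‖fkWitness (N := n + 1) v L T g X‖₊ : ℝ≥0∞)) =
      ENNReal.ofReal (fkWitness (N := n + 1) v L T g X) := by
  rw [← enorm_eq_nnnorm, Real.enorm_of_nonneg (fkWitness_nonneg v L T g X)]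

/-- **The slice law is a probability law** (private copy of the skeleton's lemma):
`∫ (∫ Ψ_T(x,Y)² dx) dY = 1` whenever the normalisation is nondegenerate. [folklore] -/
theorem lintegral_lintegral_slice_sq' {v : ℝ → ℝ≥0∞} (hv : Measurable v) (L T : ℝ)
    (h0 : fkNormSq (N := n + 1) v L T (fun _ => (1 : ℝ≥0∞)) ≠ 0)
    (htop : fkNormSq (N := n + 1) v L T (fun _ => (1 : ℝ≥0∞)) ≠ ⊤) :
    ∫⁻ Y : Config n, ∫⁻ x, slice (fkWitness (N := n + 1) v L T (fun _ => (1 : ℝ≥0∞))) Y x ^ 2 = 1 := by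
  have hm : Measurable (fkWitness (N := n + 1) v L T (fun _ => (1 : ℝ≥0∞))) :=
    measurable_fkWitness hv L T measurable_const
  have key := lintegral_config_succ (n := n)
    (F := fun Z => (‖fkWitness (N := n + 1) v L T (fun _ => (1 : ℝ≥0∞)) Z‖₊ : ℝ≥0∞) ^ 2)
    (hm.nnnorm.coe_nnreal_ennreal.pow_const 2)
  unfold slice
  rw [← key]
  simp_rw [coe_nnnorm_fkWitness']
  exact lintegral_fkWitness_sq hv L T measurable_const h0 htop

/-- **The witness slice is a constant multiple of the partition-function slice**:
`|Ψ_T(x::Y)| = (1/√‖e^{-TH}1‖₂²) · (e^{-TH}1)(x::Y)` in `[0, ∞]`, unconditionally (the constant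
is the junk `0` exactly when the normalisation is degenerate). [folklore] -/
theorem slice_fkWitness_eq_const_mul (v : ℝ → ℝ≥0∞) (L T : ℝ) (Y : Config n) (x : Space) :
    slice (fkWitness (N := n + 1) v L T (fun _ => (1 : ℝ≥0∞))) Y x =
      ENNReal.ofReal (1 / Real.sqrt (fkNormSq (N := n + 1) v L T (fun _ => (1 : ℝ≥0∞))).toReal) *
        fkSemigroup (N := n + 1) v L T (fun _ => (1 : ℝ≥0∞)) (Matrix.vecCons x Y) := by
  have hfin : fkSemigroup (N := n + 1) v L T (fun _ => (1 : ℝ≥0∞)) (Matrix.vecCons x Y) ≠ ⊤ :=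
    ne_top_of_le_ne_top ENNReal.one_ne_top (fkPartition_le_one v L T _)
  unfold slice
  rw [coe_nnnorm_fkWitness', fkWitness_apply, div_eq_mul_one_div,
    ENNReal.ofReal_mul ENNReal.toReal_nonneg, ENNReal.ofReal_toReal hfin, mul_comm]

/-- In the nondegenerate case the UV participation of the witness slice is that of the
partition-function slice. [folklore] -/
theorem uvParticipation_slice_fkWitness {v : ℝ → ℝ≥0∞} {L T : ℝ}
    (h0 : fkNormSq (N := n + 1) v L T (fun _ => (1 : ℝ≥0∞)) ≠ 0)
    (htop : fkNormSq (N := n + 1) v L T (fun _ => (1 : ℝ≥0∞)) ≠ ⊤) (Y : Config n) (K : ℕ) :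
    uvParticipation (slice (fkWitness (N := n + 1) v L T (fun _ => (1 : ℝ≥0∞))) Y) L K =
      uvParticipation
        (fun x => fkSemigroup (N := n + 1) v L T (fun _ => (1 : ℝ≥0∞)) (Matrix.vecCons x Y)) L K := by
  have hfun : slice (fkWitness (N := n + 1) v L T (fun _ => (1 : ℝ≥0∞))) Y = fun x =>
      ENNReal.ofReal (1 / Real.sqrt (fkNormSq (N := n + 1) v L T (fun _ => (1 : ℝ≥0∞))).toReal) *
        fkSemigroup (N := n + 1) v L T (fun _ => (1 : ℝ≥0∞)) (Matrix.vecCons x Y) :=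
    funext (slice_fkWitness_eq_const_mul v L T Y)
  have hpos : 0 < (fkNormSq (N := n + 1) v L T (fun _ => (1 : ℝ≥0∞))).toReal :=
    ENNReal.toReal_pos h0 htop
  have hc0 : ENNReal.ofReal
      (1 / Real.sqrt (fkNormSq (N := n + 1) v L T (fun _ => (1 : ℝ≥0∞))).toReal) ≠ 0 :=
    (ENNReal.ofReal_pos.2 (by positivity)).ne'
  rw [hfun]
  exact uvParticipation_const_mul hc0 ENNReal.ofReal_ne_top _ L K

end Witness

/-! ### The reductions (kernel-checked) -/

/-- `PartitionUVBound → SliceUVBound` (same constants). [folklore] -/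
theorem sliceUVBound_of_partitionUVBound (h : PartitionUVBound) : SliceUVBound := by
  intro v hv
  obtain ⟨ρ₀, hρ₀, H⟩ := h v hv
  refine ⟨ρ₀, hρ₀, fun ρ hρ hρlt => ?_⟩
  obtain ⟨C, hC, ev⟩ := H ρ hρ hρlt
  refine ⟨C, hC, ?_⟩
  filter_upwards [ev] with n hn T hT
  set L : ℝ := sideLength ρ (n + 1) with hLdef
  by_cases hdeg : fkNormSq (N := n + 1) v L T (fun _ => (1 : ℝ≥0∞)) = 0 ∨
      fkNormSq (N := n + 1) v L T (fun _ => (1 : ℝ≥0∞)) = ⊤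
  · have hΨ0 : ∀ X, fkWitness (N := n + 1) v L T (fun _ => (1 : ℝ≥0∞)) X = 0 :=
      fkWitness_eq_zero_of_normSq' hdeg
    have hsl : ∀ Y : Config n, slice (fkWitness (N := n + 1) v L T (fun _ => (1 : ℝ≥0∞))) Y =
        fun _ => 0 := fun Y => funext fun x => by simp [slice, hΨ0]
    refine Eventually.of_forall fun Y => ?_
    rw [hsl Y]
    simp [uvParticipation]
  simp only [not_or] at hdeg
  filter_upwards [hn T hT] with Y hY
  rwa [uvParticipation_slice_fkWitness hdeg.1 hdeg.2]

/-- **`SliceUVBound → UVFlatness`** (constant `C ↦ C²`): the slice law `m(Y)dY` is a probability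
law, so an essential bound `r̄_K ≤ C` gives `E_m[r̄_K²] ≤ C²`. [folklore] -/
theorem uvFlatness_of_sliceUVBound (h : SliceUVBound) : UVFlatness := by
  intro v hv
  obtain ⟨ρ₀, hρ₀, H⟩ := h v hv
  refine ⟨ρ₀, hρ₀, fun ρ hρ hρlt => ?_⟩
  obtain ⟨C, hC, ev⟩ := H ρ hρ hρlt
  refine ⟨C ^ 2, by positivity, ?_⟩
  filter_upwards [ev] with n hn T hT
  have hvm : Measurable v := hv.1
  set L : ℝ := sideLength ρ (n + 1) with hLdef
  set K : ℕ := depth L with hKdef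
  set Ψ : Config (n + 1) → ℝ := fkWitness (N := n + 1) v L T (fun _ => (1 : ℝ≥0∞)) with hΨdef
  by_cases hdeg : fkNormSq (N := n + 1) v L T (fun _ => (1 : ℝ≥0∞)) = 0 ∨
      fkNormSq (N := n + 1) v L T (fun _ => (1 : ℝ≥0∞)) = ⊤
  · have hΨ0 : ∀ X, Ψ X = 0 := fkWitness_eq_zero_of_normSq' hdeg
    have hsl : ∀ Y : Config n, slice Ψ Y = fun _ => 0 :=
      fun Y => funext fun x => by simp [slice, hΨ0]
    simp [hsl]
  simp only [not_or] at hdeg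
  obtain ⟨h𝒩0, h𝒩t⟩ := hdeg
  have hae : ∀ᵐ Y : Config n, (∫⁻ x, slice Ψ Y x ^ 2) * uvParticipation (slice Ψ Y) L K ^ 2 ≤
      (∫⁻ x, slice Ψ Y x ^ 2) * ENNReal.ofReal (C ^ 2) := by
    filter_upwards [hn T hT] with Y hY
    refine mul_le_mul_right ?_ _
    rw [ENNReal.ofReal_pow hC.le]
    exact pow_le_pow_left' hY 2
  calc ∫⁻ Y, (∫⁻ x, slice Ψ Y x ^ 2) * uvParticipation (slice Ψ Y) L K ^ 2
      ≤ ∫⁻ Y, (∫⁻ x, slice Ψ Y x ^ 2) * ENNReal.ofReal (C ^ 2) := lintegral_mono_ae hae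
    _ = (∫⁻ Y, ∫⁻ x, slice Ψ Y x ^ 2) * ENNReal.ofReal (C ^ 2) :=
        lintegral_mul_const' _ _ ENNReal.ofReal_ne_top
    _ = ENNReal.ofReal (C ^ 2) := by
        rw [hΨdef, lintegral_lintegral_slice_sq' hvm L T h𝒩0 h𝒩t, one_mul]

/-- **`PartitionUVBound → UVFlatness`**: the stub follows from the one missing input. [folklore] -/
theorem uvFlatness_of_partitionUVBound (h : PartitionUVBound) : UVFlatness :=
  uvFlatness_of_sliceUVBound (sliceUVBound_of_partitionUVBound h)

end Summit.AtomisticToContinuum.BoseEinsteinCondensation.Cruxes.LandscapeBound.SiblingTelescopingChaining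

end
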